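import Summits.QuantumFields.YangMills.Theorems.PoincareLipschitzMinimisingMapCompactness
import Summits.QuantumFields.YangMills.Theorems.PoincareLipschitzHKLCompetitor
import HarnessLib

/-!
# Crux `BlockLipschitzL` (stmt-QuantumFields-23533) ∕ `HistoryTailL` (stmt-QuantumFields-19936), LINE 25 «CompactnessTransfer»,
# (C)-PROOF — THE NAMED FACT `MinimisingMapCompactness` DISCHARGED

Cell `ym3-torus` (YM ladder rung R3 = continuum SU(2) Yang–Mills on T³ — a RUNG, NOT the Clay problem: not d = 4, not
infinite volume, not a mass gap); WIDTH helper seat `ym-ust-19936-w2` g13, (C)-PROOF lineage project (LEAD ★w1-19936 g10 GO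
13:49:46Z; swarm w2 ∕ w3 g15 ∕ w4 g15 ∕ px22 g7 ∕ px16 g9 ∕ px14 g6 ∕ px3 g8 ∕ w8).  Helper `--supports stmt-QuantumFields-23533`;
THEOREMS ONLY (0 `def`, 0 `sorry`, default heartbeats).  Imports: the knit ✓`…PoincareLipschitzMinimisingMapCompactness`
(`minimisingMapCompactness_of_hkl`, w2) and the HKL shell competitor ✓`…PoincareLipschitzHKLCompetitor`
(`exists_hkl_competitor`, w4 g15; built on w3 g15's ray-projection chain rule, px22 g7's projection calculus and averaging,
w4's shell interpolant).

WHAT THIS FILE DOES.  ★★★ `minimisingMapCompactness_holds : Literature.Analysis.PDE.MinimisingMapCompactness` — Luckhaus'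
compactness theorem for energy minimising maps `Q → S³` (Simon 1996 §2.9 Lemma 1), proved here along Hardt–Kinderlehrer–Lin:
the socket hypothesis of the knit is w4's `exists_hkl_competitor`, verbatim.  This discharges the FIRST named-fact hypothesis
`hC` of w3 g15's door ✓`PoincareLipschitzUniformSmallScaleEnergyOfFacts.uniformSmallScaleEnergy_band_of_facts (hC) (hR)`; the
second, (RS) = lit `MinimisingMapSmoothness` (Schoen–Uhlenbeck), remains a named fact.

HONEST SCOPE.  (C) only; (RS), S1″, S2♭″, `hHalvingBand`, K1, `MeanDeviationL`, `BlockLipschitzL`, `HistoryTailL` are NOT closed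
by this file.  YM₃ on T³ is rung R3, not Clay; YM gap NOT proved.

References: L. Simon, Theorems on Regularity and Singularity of Energy Minimizing Maps (1996) [Simon1996] (§2.9 Lemma 1 with
Remarks (1)–(2)); S. Luckhaus, Indiana Univ. Math. J. 37 (1988) 349–367 [Luckhaus1988]; R. Hardt, D. Kinderlehrer, F.-H. Lin,
Comm. Math. Phys. 105 (1986) 547–570 [HardtKinderlehrerLin1986] (§2).
-/

set_option autoImplicit false

namespace Summit.QuantumFields.YangMills.Theorems.PoincareLipschitzMinimisingMapCompactnessHolds

/-- ★★★ **(C) COMPACTNESS OF ENERGY MINIMISING MAPS `Q → S³`** (Luckhaus 1988; Simon 1996 §2.9 Lemma 1), the lit named fact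
`Literature.Analysis.PDE.MinimisingMapCompactness`, BY NAME and hypothesis-free: the knit `minimisingMapCompactness_of_hkl`
fed with the Hardt–Kinderlehrer–Lin shell competitor `exists_hkl_competitor`. [cite: Simon1996, §2.9 Lemma 1 with Remarks (1)–(2);
Luckhaus1988, compactness theorem; HardtKinderlehrerLin1986, §2] -/
theorem minimisingMapCompactness_holds : Literature.Analysis.PDE.MinimisingMapCompactness := by
  obtain ⟨K, hK, h⟩ := Summit.QuantumFields.YangMills.Theorems.PoincareLipschitzHKLCompetitor.exists_hkl_competitor
  exact Summit.QuantumFields.YangMills.Theorems.PoincareLipschitzMinimisingMapCompactness.minimisingMapCompactness_of_hkl hK h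

end Summit.QuantumFields.YangMills.Theorems.PoincareLipschitzMinimisingMapCompactnessHolds
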